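import Summits.QuantumFields.BalabanUV.T4Continuum.Support.RegionStarGradientLinear

/-!
# T⁴ programme, spine node NE2 (U1a), sub-row Δ1 «NE2⁰-Dirichlet» — THE ZERO-EXTENSION GRADIENT ENERGY OF A STAR-BOND FIELD IN THE
# LINEAR-GROWTH CLASS: `Σ_ν ‖∇_ν ιA‖² ≤ (C₀ + C₁·n)·Re⟨A, Δ_a(Ω₀)A⟩` on coordinate boxes — the W2 binder `hgrad` of the COMPRESSED star tower
# (`DirichletStarVectorTower.towerLimitRate_star_of_linear`) DISCHARGED in the class that `DirichletStarSlabMode` proves minimal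

NE2 formalisation swarm `b2b-balaban-t4-ne2-formalise-*`, LEAF PROVER 06 (gen 6), item 2 «Δ1-VEC-W2-LINEAR-BOX» (journal 2026-08-20
l.21157), file 2 of 2, on file 1 `Support/RegionStarGradientLinear` (`extFlux_le_trace : extFlux A ≤ 4d·n·(2·nsq A + Σ_ν nsq (igrad_ν A))`, both
spike families by the trace inequalities), leaf-07-g6's `RegionGaffneyIdentity.gaffney_region`, leaf-07-g7's `RegionInteriorW2` (`nsq_eq_add`,
`nsq_gaugeP_div_le`, `interiorW2_of_slice`, `CgIbox`), the owner's O14-a `RegionSliceCoerciveBox.sliceCoercive_lev_box` (W1 on boxes at every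
level) and gen-13 `DirichletStarVectorTower.towerLimitRate_star_of_linear`.

 * §3 **`gradEnergy_le (ha : 0 ≤ a) (ha′ : 0 < a′) : Σ_ν nsq (fdiff ν (ext A)) ≤ Re⟨A, Δ_a(Ω₀)A⟩ + γ′⁻³σ₀⁻⁴·nsq A + 4d·n·(2·nsq A + Σ_ν nsq
   (igrad_ν A))`** (ANY union) and, with W1 (`Coercive … γ`) and interior W2 (`CgI`) displayed, **`gradEnergy_le_form : … ≤ (1 + γ′⁻³σ₀⁻⁴γ⁻¹ +
   4d·n·(2γ⁻¹ + CgI))·Re⟨A, Δ_a(Ω₀)A⟩`** — LINEAR in `n`; by `DirichletStarSlabMode.slab_mode_forces_linear_growth` (`n ≤ a·Cg` on the slab)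
   no level-uniform constant exists, so the class is sharp; `gradEnergy_le_crude` (`≤ 4d·n²·nsq`, level `0`);
 * §4 ON COORDINATE BOXES (`2 ≤ L`): **`hgrad_box`** `∀ k ν w, nsq (fdiff ν (ext w)) ≤ (CgLin0 + CgLin1·n_k)·Re⟨w, D_k w⟩`
   (`CgLin0 = 1 + γ′⁻³σ₀⁻⁴γ⋆⁻¹ + 4dγ⋆⁻¹`, `CgLin1 = 4d(2γ⋆⁻¹ + CgIbox)`, `γ⋆ = gamStar d a′ (cW1box d a a′ 4)`), `CgLin_le_pow`
   (`≤ (CgLin0 + CgLin1)·L^k`), and the END **`towerLimitRate_star_box_of_compressed (hL) (hbox) (ha : 0 < a) (ha′) (hθ : (√L)⁻¹ ≤ θ)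
   (hθ1 : θ < 1) (hinjK : ∀ k, ‖G_{k+1}·JpR k − JpR k·G_k‖ ≤ C₁θ^k)`** = the owner's `towerLimitRate_star_of_linear` with W1 :=
   `sliceCoercive_lev_box` and W2 := `hgrad_box`: the COMPRESSED star tower of the faithful `Δ_a(Ω₀)` on every coordinate box converges at every
   rate `θ ∈ [(√L)⁻¹, 1)` MODULO KING's COMPRESSED INJECTED LAW AT RATE `θ` ONLY — the twin of this seat's
   `DirichletStarRenormBoxTower.towerLimitRate_star_renorm_box_of_compressed`: BOTH box star towers display ONE and the same binder.

HONEST FRAMING (T4-DAG p. 1).  [folklore] finite lattice calculus on the cell's typed `U = 1` objects (one region, one averaging scale, finite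
torus, operator norm); constants OURS; W1 / interior W2 displayed in §3, theorems on boxes in §4; the injected law W3 for King's compressed
planting NOT proved — displayed (`hinjK`); Δ1 NOT closed; NE2 (U1a) NOT proved; spine PROVED 0/9 unchanged; NOT [B9] (3.16)/(3.23)–(3.27) as
printed; NOT infinite volume / mass gap / Clay.  HONEST DEPENDENCY: continuum YM on T⁴ ⇐ BetaPertH ∧ nine spine estimates (0/9 proved); BetaPertH
⇐ (D1) ∧ (D4) ∧ CAP+tail; G-an2-4 gates asym, D1 and NE2/3/4.  No `sorry`.
-/

noncomputable section

open scoped BigOperators ComplexConjugate Matrix Matrix.Norms.L2Operator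
open Finset

namespace Summit.QuantumFields.BalabanUV.T4Continuum.RegionStarGradientLinearBox

open Literature.MathematicalPhysics.QuantumFieldTheory.Balaban1983to89.B5Prop11Plancherel (Tor fine unitVec fdiff)
open Literature.MathematicalPhysics.QuantumFieldTheory.Balaban1983to89.B5Prop11Lower (nsq nsq_nonneg)
open Literature.MathematicalPhysics.QuantumFieldTheory.Balaban1983to89.B5Action121 (GradOp GradOp_conjTranspose_mulVec divS_apply)
open Literature.MathematicalPhysics.QuantumFieldTheory.Balaban1983to89.B5Block118 (bpt tstep tstep_zero tstep_succ)
open Literature.MathematicalPhysics.QuantumFieldTheory.Balaban1983to89.B5Blocks16 (blockOf blockOf_bpt)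
open Literature.MathematicalPhysics.QuantumFieldTheory.Balaban1983to89.B5G183RateUnitTower (lev)
open Literature.MathematicalPhysics.QuantumFieldTheory.Balaban1983to89.B5G183FreeRowSum (fdiff_mulVec)
open Summit.QuantumFields.BalabanUV.T4Continuum
open Summit.QuantumFields.BalabanUV.T4Continuum.CovariantAveragingTower (TowerLimitRate)
open Summit.QuantumFields.BalabanUV.T4Continuum.BackgroundResolventTower (Cpert)
open Summit.QuantumFields.BalabanUV.T4Continuum.BalabanAveragedTowerUnit (cast_lev')
open Summit.QuantumFields.BalabanUV.T4Continuum.SubtypeCompression (ext ext_apply_of ext_apply_of_not nsq_ext Coercive)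
open Summit.QuantumFields.BalabanUV.T4Continuum.ScalarBlockTrialFunction (digits digits_bpt)
open Summit.QuantumFields.BalabanUV.T4Continuum.ScalarAveragedPropagator (gammaPs gammaPs_pos)
open Summit.QuantumFields.BalabanUV.T4Continuum.ScalarAveragedCompression (sigma0 sigma0_pos)
open Summit.QuantumFields.BalabanUV.T4Continuum.RegionGaugeSlice (SliceCoercive)
open Summit.QuantumFields.BalabanUV.T4Continuum.RegionScalarCompression (QOm GOm)
open Summit.QuantumFields.BalabanUV.T4Continuum.RegionGaugeProjection (gaugeP gaugeR)
open Summit.QuantumFields.BalabanUV.T4Continuum.RegionGaugeFixedVector (starReg curlR gradR avgR regionDeltaA form_regionDeltaA)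
open Summit.QuantumFields.BalabanUV.T4Continuum.RegionGaugeFixedVectorFlat (bpt_blockOf_digits)
open Summit.QuantumFields.BalabanUV.T4Continuum.DirichletSubregionTowerOf (pidx QpR JpR)
open Summit.QuantumFields.BalabanUV.T4Continuum.DirichletStarVectorTower (starP digit_eq_of_blockOf_ne gamStar gamStar_pos
  coercive_regionDeltaA_of_slice two_le_lev_succ towerLimitRate_star_of_linear)
open Summit.QuantumFields.BalabanUV.T4Continuum.DirichletStarRenormTower (igrad)
open Summit.QuantumFields.BalabanUV.T4Continuum.RegionFaceFluxChart (gI gI_nonneg sum_gI_eq gI_eq_of_star)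
open Summit.QuantumFields.BalabanUV.T4Continuum.RegionGaffneyIdentity (extFlux extFlux_nonneg gaffney_region)
open Summit.QuantumFields.BalabanUV.T4Continuum.RegionInteriorW2 (CgIbox one_le_CgIbox nsq_eq_add nsq_gaugeP_div_le interiorW2_of_slice)
open Summit.QuantumFields.BalabanUV.T4Continuum.RegionSliceCoerciveBoxTower (cW1box cW1box_pos)
open Summit.QuantumFields.BalabanUV.T4Continuum.RegionSliceCoerciveBox (sliceCoercive_lev_box)
open Summit.QuantumFields.BalabanUV.T4Continuum.RegionStarTrace (defSet trace_deficient_le)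
open Summit.QuantumFields.BalabanUV.T4Continuum.RegionStarGradientLinear (outSet trace_outward_le extFlux_le_trace)
open Summit.QuantumFields.BalabanUV.Beta.GAN24.DirichletBoxTrace (blockReg bpt_update_add_tstep bpt_eq_update_add)
open Summit.QuantumFields.BalabanUV.Beta.GAN24.DirichletBoxTwoLevel (IsCoordBox)

/-! ## §3 The zero-extension gradient energy against the faithful form -/

section Form

variable {d : ℕ} (n : ℕ) [NeZero n] (M : Fin d → ℕ) [hM : ∀ μ, NeZero (M μ)] (S : Tor M → Prop) [DecidablePred S] (a a' : ℝ)

/-- the faithful curl + region-divergence energies against the form: `‖curlR A‖² + ‖∂_ΩᴴA‖² ≤ Re⟨A, Δ_a(Ω₀)A⟩ + γ′⁻³σ₀⁻⁴·nsq A` (`0 ≤ a`,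
`0 < a′`; the gauge projection's share `‖P·∂_ΩᴴA‖²` is bounded by leaf-07-g7's `nsq_gaugeP_div_le`). [folklore] -/
theorem curl_add_div_le_form (ha : 0 ≤ a) (ha' : 0 < a') (A : {b // starReg n M S b} → ℂ) :
    nsq (curlR n M S *ᵥ A) + nsq ((gradR n M S)ᴴ *ᵥ A)
      ≤ (star A ⬝ᵥ (regionDeltaA n M a a' S *ᵥ A)).re + ((gammaPs d a')⁻¹) ^ 3 * (((sigma0 d a') ^ 2)⁻¹) ^ 2 * nsq A := by
  rw [form_regionDeltaA n M a a' S ha', nsq_eq_add n M a' S ha' ((gradR n M S)ᴴ *ᵥ A)]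
  have h1 := nsq_gaugeP_div_le n M a' S ha' A
  have h2 : 0 ≤ a * (n : ℝ) ^ d * nsq (avgR n M S *ᵥ A) := by have := nsq_nonneg (avgR n M S *ᵥ A); positivity
  linarith

/-- **THE ZERO-EXTENSION GRADIENT ENERGY** on ANY union of blocks:
`Σ_ν ‖∇_ν ιA‖² ≤ Re⟨A, Δ_a(Ω₀)A⟩ + γ′⁻³σ₀⁻⁴·nsq A + 4d·n·(2·nsq A + Σ_ν nsq (igrad_ν A))`. [folklore] -/
theorem gradEnergy_le (ha : 0 ≤ a) (ha' : 0 < a') (A : {b // starReg n M S b} → ℂ) :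
    ∑ ν, nsq (fdiff (fine n M) (n : ℂ) ν *ᵥ ext (starReg n M S) A)
      ≤ (star A ⬝ᵥ (regionDeltaA n M a a' S *ᵥ A)).re + ((gammaPs d a')⁻¹) ^ 3 * (((sigma0 d a') ^ 2)⁻¹) ^ 2 * nsq A
          + 4 * d * (n : ℝ) * (2 * nsq A + ∑ ν, nsq (igrad M S n ν A)) := by
  rw [← gaffney_region]
  have h1 := curl_add_div_le_form n M S a a' ha ha' A
  have h2 := extFlux_le_trace n M S A
  linarith

/-- **… IN THE LINEAR-GROWTH CLASS** from W1 (`Coercive … γ`) and interior W2 (`CgI`), both displayed: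
`Σ_ν ‖∇_ν ιA‖² ≤ (1 + γ′⁻³σ₀⁻⁴·γ⁻¹ + 4d·n·(2γ⁻¹ + CgI))·Re⟨A, Δ_a(Ω₀)A⟩` — the factor `n` is the slab mode's
(`DirichletStarSlabMode.slab_mode_forces_linear_growth`). [folklore] -/
theorem gradEnergy_le_form (ha : 0 ≤ a) (ha' : 0 < a') {γ CgI : ℝ} (hγ : 0 < γ)
    (hcoer : Coercive (regionDeltaA n M a a' S) γ)
    (hI : ∀ w : {b // starReg n M S b} → ℂ,
      ∑ μ, nsq (igrad M S n μ w) ≤ CgI * (star w ⬝ᵥ (regionDeltaA n M a a' S *ᵥ w)).re)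
    (A : {b // starReg n M S b} → ℂ) :
    ∑ ν, nsq (fdiff (fine n M) (n : ℂ) ν *ᵥ ext (starReg n M S) A)
      ≤ (1 + ((gammaPs d a')⁻¹) ^ 3 * (((sigma0 d a') ^ 2)⁻¹) ^ 2 * γ⁻¹ + 4 * d * (n : ℝ) * (2 * γ⁻¹ + CgI))
          * (star A ⬝ᵥ (regionDeltaA n M a a' S *ᵥ A)).re := by
  set X := (star A ⬝ᵥ (regionDeltaA n M a a' S *ᵥ A)).re with hX
  have h0 := gradEnergy_le n M S a a' ha ha' A
  have hc := hcoer A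
  have hX0 : 0 ≤ X := le_trans (mul_nonneg hγ.le (nsq_nonneg A)) hc
  have hA : nsq A ≤ γ⁻¹ * X := by rw [le_inv_mul_iff₀' hγ]; linarith
  have hIA := hI A
  have hc1 : 0 ≤ ((gammaPs d a')⁻¹) ^ 3 * (((sigma0 d a') ^ 2)⁻¹) ^ 2 := by
    have := (gammaPs_pos (d := d) (a' := a')).1; have := sigma0_pos (d := d) ha'; positivity
  have hdn : 0 ≤ 4 * (d : ℝ) * n := by positivity
  have h1 := mul_le_mul_of_nonneg_left hA hc1
  have h2 : 4 * d * (n : ℝ) * (2 * nsq A + ∑ ν, nsq (igrad M S n ν A)) ≤ 4 * d * (n : ℝ) * (2 * (γ⁻¹ * X) + CgI * X) :=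
    mul_le_mul_of_nonneg_left (by linarith) hdn
  calc _ ≤ X + ((gammaPs d a')⁻¹) ^ 3 * (((sigma0 d a') ^ 2)⁻¹) ^ 2 * nsq A
          + 4 * d * (n : ℝ) * (2 * nsq A + ∑ ν, nsq (igrad M S n ν A)) := h0
    _ ≤ X + ((gammaPs d a')⁻¹) ^ 3 * (((sigma0 d a') ^ 2)⁻¹) ^ 2 * (γ⁻¹ * X) + 4 * d * (n : ℝ) * (2 * (γ⁻¹ * X) + CgI * X) := by
        linarith
    _ = _ := by ring

/-- the CRUDE bound `Σ_ν ‖∇_ν v‖² ≤ 4d·n²·nsq v` for any bond field on the torus (used at level `0`). [folklore] -/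
theorem gradEnergy_le_crude (v : Tor (fine n M) × Fin d → ℂ) :
    ∑ ν, nsq (fdiff (fine n M) (n : ℂ) ν *ᵥ v) ≤ 4 * d * (n : ℝ) ^ 2 * nsq v := by
  have hν : ∀ ν : Fin d, nsq (fdiff (fine n M) (n : ℂ) ν *ᵥ v) ≤ 4 * (n : ℝ) ^ 2 * nsq v := by
    intro ν
    have hshift : ∑ c : Tor (fine n M) × Fin d, ‖v (c.1 + unitVec (fine n M) ν, c.2)‖ ^ 2 = nsq v := by
      unfold nsq
      rw [Fintype.sum_prod_type, Fintype.sum_prod_type]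
      exact Fintype.sum_equiv (Equiv.addRight (unitVec (fine n M) ν)) _ _ fun x => rfl
    have hpt : ∀ c : Tor (fine n M) × Fin d, ‖(fdiff (fine n M) (n : ℂ) ν *ᵥ v) c‖ ^ 2
        ≤ 2 * (n : ℝ) ^ 2 * (‖v (c.1 + unitVec (fine n M) ν, c.2)‖ ^ 2 + ‖v c‖ ^ 2) := by
      intro c
      rw [fdiff_mulVec, norm_mul, Complex.norm_natCast, mul_pow]
      have h := norm_sub_le (v (c.1 + unitVec (fine n M) ν, c.2)) (v c)
      have h2 : ‖v (c.1 + unitVec (fine n M) ν, c.2) - v c‖ ^ 2 ≤ 2 * (‖v (c.1 + unitVec (fine n M) ν, c.2)‖ ^ 2 + ‖v c‖ ^ 2) := by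
        nlinarith [norm_nonneg (v (c.1 + unitVec (fine n M) ν, c.2) - v c), norm_nonneg (v (c.1 + unitVec (fine n M) ν, c.2)),
          norm_nonneg (v c), sq_nonneg (‖v (c.1 + unitVec (fine n M) ν, c.2)‖ - ‖v c‖)]
      have h3 := mul_le_mul_of_nonneg_left h2 (sq_nonneg (n : ℝ))
      linarith
    calc nsq (fdiff (fine n M) (n : ℂ) ν *ᵥ v) = ∑ c, ‖(fdiff (fine n M) (n : ℂ) ν *ᵥ v) c‖ ^ 2 := rfl
      _ ≤ ∑ c, 2 * (n : ℝ) ^ 2 * (‖v (c.1 + unitVec (fine n M) ν, c.2)‖ ^ 2 + ‖v c‖ ^ 2) := sum_le_sum fun c _ => hpt c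
      _ = 4 * (n : ℝ) ^ 2 * nsq v := by rw [← mul_sum, sum_add_distrib, hshift]; unfold nsq; ring
  calc ∑ ν, nsq (fdiff (fine n M) (n : ℂ) ν *ᵥ v) ≤ ∑ _ν : Fin d, 4 * (n : ℝ) ^ 2 * nsq v := sum_le_sum fun ν _ => hν ν
    _ = 4 * d * (n : ℝ) ^ 2 * nsq v := by rw [sum_const, card_univ, Fintype.card_fin, nsmul_eq_mul]; ring

end Form

/-! ## §4 Coordinate boxes: the W2 binder of the compressed star tower in the linear class, and the END -/

section Box

variable {d : ℕ} (L : ℕ) [NeZero L] (M : Fin d → ℕ) [hM : ∀ μ, NeZero (M μ)] (S : Tor M → Prop) [DecidablePred S] (a a' : ℝ)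

/-- the level-`0` part of the W2 constant on boxes: `C₀ = 1 + γ′⁻³σ₀⁻⁴γ⋆⁻¹ + 4d·γ⋆⁻¹` (`γ⋆ = gamStar d a′ (cW1box d a a′ 4)`). [folklore] -/
def CgLin0 (d : ℕ) (a a' : ℝ) : ℝ :=
  1 + ((gammaPs d a')⁻¹) ^ 3 * (((sigma0 d a') ^ 2)⁻¹) ^ 2 * (gamStar d a' (cW1box d a a' 4))⁻¹ + 4 * d * (gamStar d a' (cW1box d a a' 4))⁻¹

/-- the slope of the W2 constant on boxes: `C₁ = 4d·(2γ⋆⁻¹ + CgIbox)`. [folklore] -/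
def CgLin1 (d : ℕ) (a a' : ℝ) : ℝ :=
  4 * d * (2 * (gamStar d a' (cW1box d a a' 4))⁻¹ + CgIbox d a' (cW1box d a a' 4))

omit [NeZero L] hM [DecidablePred S] in
/-- `0 ≤ C₀`, `0 ≤ C₁` (`0 < a`, `0 < a′`). [folklore] -/
theorem CgLin_nonneg (ha : 0 < a) (ha' : 0 < a') : 0 ≤ CgLin0 d a a' ∧ 0 ≤ CgLin1 d a a' := by
  have hγ : 0 < gamStar d a' (cW1box d a a' 4) := gamStar_pos (d := d) a' (cW1box_pos (d := d) a a' ha ha')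
  have := (gammaPs_pos (d := d) (a' := a')).1
  have := sigma0_pos (d := d) ha'
  have := one_le_CgIbox (d := d) a' ha' (cW1box_pos (d := d) a a' (Cf := 4) ha ha')
  unfold CgLin0 CgLin1
  constructor <;> positivity

/-- **THE W2 BINDER OF THE COMPRESSED STAR TOWER ON A COORDINATE BOX, IN THE LINEAR CLASS**: for every level `k`, direction `ν` and
star-bond field `w`, `‖∇_ν ιw‖² ≤ (C₀ + C₁·n_k)·Re⟨w, Δ_a^{(k)}(Ω₀) w⟩` (level `0` by the crude bound, levels `k + 1` by §3 with W1 :=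
the owner's `sliceCoercive_lev_box` and interior W2 := leaf-07-g7's `interiorW2_of_slice`). [folklore] -/
theorem hgrad_box (hL : 2 ≤ L) (hbox : IsCoordBox M S) (ha : 0 < a) (ha' : 0 < a') (k : ℕ) (ν : Fin d)
    (w : pidx L M (starP L M S) k → ℂ) :
    nsq (fdiff (fine (lev L k) M) ((lev L k : ℕ) : ℂ) ν *ᵥ ext (starP L M S k) w)
      ≤ (CgLin0 d a a' + CgLin1 d a a' * ((lev L k : ℕ) : ℝ)) * (star w ⬝ᵥ (regionDeltaA (lev L k) M a a' S *ᵥ w)).re := by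
  set c := cW1box d a a' 4 with hc
  have hcpos : 0 < c := cW1box_pos (d := d) a a' ha ha'
  have hγ : 0 < gamStar d a' c := gamStar_pos (d := d) a' hcpos
  have hcoer : ∀ j, Coercive (regionDeltaA (lev L j) M a a' S) (gamStar d a' c) :=
    fun j => coercive_regionDeltaA_of_slice (lev L j) M a a' S ha' hcpos (sliceCoercive_lev_box M a a' S L hL hbox ha ha' j)
  have hX0 : 0 ≤ (star w ⬝ᵥ (regionDeltaA (lev L k) M a a' S *ᵥ w)).re :=
    le_trans (mul_nonneg hγ.le (nsq_nonneg w)) (hcoer k w)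
  obtain ⟨hC0, hC1⟩ := CgLin_nonneg (d := d) a a' ha ha'
  -- one direction is bounded by the sum over directions
  have hone : nsq (fdiff (fine (lev L k) M) ((lev L k : ℕ) : ℂ) ν *ᵥ ext (starP L M S k) w)
      ≤ ∑ μ, nsq (fdiff (fine (lev L k) M) ((lev L k : ℕ) : ℂ) μ *ᵥ ext (starP L M S k) w) :=
    single_le_sum (f := fun μ => nsq (fdiff (fine (lev L k) M) ((lev L k : ℕ) : ℂ) μ *ᵥ ext (starP L M S k) w))
      (fun μ _ => nsq_nonneg _) (mem_univ ν)
  refine hone.trans ?_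
  rcases k with _ | k
  · -- level 0: `n = 1`, crude bound `4d·nsq w ≤ 4d·γ⋆⁻¹·X ≤ C₀·X`
    have hw : nsq w ≤ (gamStar d a' c)⁻¹ * (star w ⬝ᵥ (regionDeltaA (lev L 0) M a a' S *ᵥ w)).re := by
      rw [le_inv_mul_iff₀' hγ]; linarith [hcoer 0 w]
    have h1 := gradEnergy_le_crude (lev L 0) M (ext (starP L M S 0) w)
    rw [nsq_ext] at h1
    have hlev : ((lev L 0 : ℕ) : ℝ) = 1 := by rw [cast_lev' L 0, pow_zero]
    rw [hlev] at h1 ⊢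
    have h2 : 4 * (d : ℝ) * nsq w ≤ 4 * d * (gamStar d a' c)⁻¹ * (star w ⬝ᵥ (regionDeltaA (lev L 0) M a a' S *ᵥ w)).re := by
      have := mul_le_mul_of_nonneg_left hw (show (0 : ℝ) ≤ 4 * d by positivity); linarith
    have h3 : 4 * (d : ℝ) * (gamStar d a' c)⁻¹ ≤ CgLin0 d a a' + CgLin1 d a a' * 1 := by
      rw [mul_one]; unfold CgLin0
      have := (gammaPs_pos (d := d) (a' := a')).1; have := sigma0_pos (d := d) ha'
      have : 0 ≤ ((gammaPs d a')⁻¹) ^ 3 * (((sigma0 d a') ^ 2)⁻¹) ^ 2 * (gamStar d a' c)⁻¹ := by positivity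
      linarith
    calc _ ≤ 4 * (d : ℝ) * 1 ^ 2 * nsq w := h1
      _ = 4 * (d : ℝ) * nsq w := by ring
      _ ≤ 4 * d * (gamStar d a' c)⁻¹ * (star w ⬝ᵥ (regionDeltaA (lev L 0) M a a' S *ᵥ w)).re := h2
      _ ≤ (CgLin0 d a a' + CgLin1 d a a' * 1) * (star w ⬝ᵥ (regionDeltaA (lev L 0) M a a' S *ᵥ w)).re :=
          mul_le_mul_of_nonneg_right h3 hX0
  · -- level k+1: §3 with W1 + interior W2 on boxes
    have hn2 : 2 ≤ lev L (k + 1) := two_le_lev_succ L hL k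
    have hCg0 : 0 ≤ CgIbox d a' c := zero_le_one.trans (one_le_CgIbox (d := d) a' ha' hcpos)
    have hI : ∀ u : pidx L M (starP L M S) (k + 1) → ℂ,
        ∑ μ, nsq (igrad M S (lev L (k + 1)) μ u) ≤ CgIbox d a' c * (star u ⬝ᵥ (regionDeltaA (lev L (k + 1)) M a a' S *ᵥ u)).re :=
      fun u => interiorW2_of_slice (lev L (k + 1)) M a a' S hn2 hbox ha.le ha' hcpos (sliceCoercive_lev_box M a a' S L hL hbox ha ha' (k + 1)) u
    have h1 := gradEnergy_le_form (lev L (k + 1)) M S a a' ha.le ha' hγ (hcoer (k + 1)) hI w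
    refine h1.trans (mul_le_mul_of_nonneg_right ?_ hX0)
    unfold CgLin0 CgLin1
    have h4 : 0 ≤ 4 * (d : ℝ) * (gamStar d a' c)⁻¹ := by positivity
    nlinarith [h4]

omit [NeZero L] hM [DecidablePred S] in
/-- the linear class sits inside `Cg₀·L^k` with `Cg₀ = C₀ + C₁`. [folklore] -/
theorem CgLin_le_pow (hL : 1 ≤ L) (ha : 0 < a) (ha' : 0 < a') (k : ℕ) :
    CgLin0 d a a' + CgLin1 d a a' * ((lev L k : ℕ) : ℝ) ≤ (CgLin0 d a a' + CgLin1 d a a') * (L : ℝ) ^ k := by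
  obtain ⟨hC0, hC1⟩ := CgLin_nonneg (d := d) a a' ha ha'
  rw [cast_lev' L k]
  have h1 : (1 : ℝ) ≤ (L : ℝ) ^ k := one_le_pow₀ (by exact_mod_cast hL)
  nlinarith

/-- **THE COMPRESSED STAR TOWER OF THE FAITHFUL `Δ_a(Ω₀)` ON A COORDINATE BOX AT RATE `θ ∈ [(√L)⁻¹, 1)` MODULO KING's COMPRESSED INJECTED
LAW AT RATE `θ` ONLY** — the owner's `DirichletStarVectorTower.towerLimitRate_star_of_linear` with W1 := `sliceCoercive_lev_box` and
W2 := `hgrad_box`; the twin of `DirichletStarRenormBoxTower.towerLimitRate_star_renorm_box_of_compressed` (same displayed binder). [folklore] -/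
theorem towerLimitRate_star_box_of_compressed (hL : 2 ≤ L) (hbox : IsCoordBox M S) (ha : 0 < a) (ha' : 0 < a')
    {θ C₁ : ℝ} (hθ : (Real.sqrt L)⁻¹ ≤ θ) (hθ1 : θ < 1)
    (hinjK : ∀ k, ‖(regionDeltaA (lev L (k + 1)) M a a' S)⁻¹ * JpR L M (starP L M S) k
        - JpR L M (starP L M S) k * (regionDeltaA (lev L k) M a a' S)⁻¹‖ ≤ C₁ * θ ^ k) :
    TowerLimitRate (QpR L M (starP L M S)) ((L : ℝ) ^ d) (fun k => (regionDeltaA (lev L k) M a a' S)⁻¹)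
      (Cpert 0 (2 * d * Real.sqrt ((CgLin0 d a a' + CgLin1 d a a') * L * (gamStar d a' (cW1box d a a' 4))⁻¹)) C₁ 0
        ((gamStar d a' (cW1box d a a' 4))⁻¹ + Real.sqrt (d * ((CgLin0 d a a' + CgLin1 d a a') * L) * (gamStar d a' (cW1box d a a' 4))⁻¹))
        0) θ := by
  have hL1 : 1 ≤ L := le_trans (by norm_num) hL
  obtain ⟨hC0, hC1⟩ := CgLin_nonneg (d := d) a a' ha ha'
  exact towerLimitRate_star_of_linear L M a a' S hL ha' (cW1box_pos (d := d) a a' ha ha') (sliceCoercive_lev_box M a a' S L hL hbox ha ha')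
    (Cg := fun k => CgLin0 d a a' + CgLin1 d a a' * ((lev L k : ℕ) : ℝ))
    (fun k => by have : (0 : ℝ) ≤ ((lev L k : ℕ) : ℝ) := Nat.cast_nonneg _; positivity)
    (fun k => CgLin_le_pow L a a' hL1 ha ha' k) (fun k ν w => hgrad_box L M S a a' hL hbox ha ha' k ν w) hθ hθ1 hinjK

end Box

end Summit.QuantumFields.BalabanUV.T4Continuum.RegionStarGradientLinearBox

end
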